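import Summits.QuantumFields.YangMills.Theorems.DiagonalMirrorRPRTwoShiftProbesAt
import Summits.QuantumFields.YangMills.Theorems.DiagonalMirrorRPRWilsonDiagonalModelTwoShiftPairing

/-!
# Crux `WeakCouplingHypercubicLimitRP` (stmt-QuantumFields-27398), door B, R1-side, item (ii) — THE INHABITANT:
# `twoShiftIdentitiesAt … : TwoShiftIdentities r sch hβ P` for a pinned probe, from the two-shift formula on `slicePkgAt`

Helper file (`--supports stmt-QuantumFields-27398 --as helper`) of the hand `hand-10604-wilsonDiagModel-2` g3 (docket director-ym g24, O4 WORD 47 (2) /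
48 (2) / 50 (1) / 51 (1): «hand-2's (ii) deliverable becomes, by name, a term `… : TwoShiftIdentities r sch hβ P` for the pinned probe `P` of record whose
`ident₁`∕`ident₂` are the two `HasSum` shapes at `m = P.n k` and `m = 2·P.n k`»); it closes nothing by itself.

WHAT.  Hand-3's contract `TwoShiftIdentities r sch hβ P` (✓ `…DiagonalMirrorRPRTwoShiftProbesAt`, §1) is INHABITED for every pinned probe
`P : PinnedProbe sch` (✓ `…TwoShiftProbesPinnedDefs`) whose shift and box obey the displayed arithmetic regime
`n_k ≠ 0`, `side_k ≤ 16·n_k`, `48·n_k + 16·(2T_k + 1) ≤ 5·side_k` eventually (met by `n_k ≍ side_k/16`, `T_k ≤ side_k/16 − O(1)`, in particular by every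
box of bounded physical size since `a_k side_k → ∞`):
* `N_k := side_k` (the number of layers of the scheme's own odd torus = the chain length of `Tr K_u^{side_k}`), `d_k := 2T_k + 1` (the reading depth of a
  `diagBox T_k`-local functional in the symmetric chart: layers `1, …, 2T_k + 1`), `Z_k := diagCyclicTraceU ρ β_k side_k = Tr K_u^{side_k} > 0`,
  `w_k := (slicePkgAt r sch hβ k).twoShiftWeight (obsRead side_k (P.Y k) (2T_k))` (`= ⟪ψ_b, 𝒯_{Y_k} ψ_a⟫² ≥ 0`, summable = Hilbert–Schmidt);
* `ident₁`, `ident₂` = ✓ `hasSum_twoShift_slicePkgAt` (`…WilsonDiagonalModelTwoShiftPairing`, item (ii) step 5) at `n := P.n k` and `n := 2·P.n k`;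
  `le_N`, `p_ge` = the regime hypothesis rearranged.
With `twoShiftIdentitiesAt`, hand-3's `twoShiftProbesAt (twoShiftIdentitiesAt …) C hC hc` is the sandwich instance ON THE PROBE OF RECORD, parametric only
in the displayed coupling letter `hc : SlowCoupled _` (WORD 48 (4) option A) and `C ≥ 0`.

HONEST FRAMING: an inhabitation by identities; the regime hypotheses are arithmetic on `(n_k, T_k, side_k)` and say nothing about Wilson's measure; the
letters K1 `CoarseGap ∧ JunkVisible`, K2 `SlowestVisible`, `SlowCoupled`, `RPSpectral`, R2♭ remain OPEN physics; D1′, ⟨27398⟩ (0∕2), S6i and the aside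
⟨10604⟩ are OPEN; the Yang–Mills mass gap is NOT proved here or anywhere in the tree.  One `def` (the structure term), no instance, no notation,
`autoImplicit false`.

References: K. Osterwalder, E. Seiler, Ann. Phys. 110 (1978) §2–3; I. Montvay, G. Münster (1994) §1.5.2; B. Simon, *Trace Ideals* (2005) Ch. 3.
-/

set_option autoImplicit false

noncomputable section

open MeasureTheory Filter Topology
open Literature.MathematicalPhysics.QuantumLattice Literature.MathematicalPhysics.QuantumFieldTheory
open Summit.QuantumFields.YangMills.Cruxes.DiagonalMirrorRPR.SignTwistedDiagonalTrace.WilsonDiagonal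

namespace Summit.QuantumFields.YangMills.Cruxes.DiagonalMirrorRPR.SpectralTransfer

variable {G : Type} [Group G] [TopologicalSpace G] [IsTopologicalGroup G] [CompactSpace G]
  [MeasurableSpace G] [BorelSpace G] (r : LatticeRep G) (sch : SpeciesScheme (YMSpecies G))

/-- The regime `48 n + 16 (2T + 1) ≤ 5 side` implies the room `6 n + 2 (2T + 1) ≤ side` (and more). -/
theorem six_mul_add_two_mul_le_of_regime {n T side : ℕ} (h : 48 * n + 16 * (2 * T + 1) ≤ 5 * side) :
    6 * n + 2 * (2 * T + 1) ≤ side := by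
  omega

/-- ★★★ **The two-shift identities of a pinned probe, inhabited** (item (ii)'s term for hand-3's contract): for every pinned probe `P` in the displayed
arithmetic regime, `TwoShiftIdentities r sch hβ P` with `N_k = side_k`, `d_k = 2T_k + 1`, `Z_k = Tr K_u^{side_k}`, `w_k = ⟪ψ_b, 𝒯_{Y_k} ψ_a⟫²` on
`slicePkgAt r sch hβ k`, and both identities from `hasSum_twoShift_slicePkgAt`. -/
def twoShiftIdentitiesAt (hβ : ∀ k, 0 ≤ sch.β k) (P : PinnedProbe sch) (hn0 : ∀ k, P.n k ≠ 0)
    (hnge : ∀ᶠ k in atTop, (sch.side k : ℝ) ≤ 16 * P.n k)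
    (hreg : ∀ᶠ k in atTop, 48 * P.n k + 16 * (2 * P.T k + 1) ≤ 5 * sch.side k) :
    TwoShiftIdentities r sch hβ P where
  N := fun k => sch.side k
  d := fun k => 2 * P.T k + 1
  Z := fun k => diagCyclicTraceU r.ρ (sch.β k) (sch.side k) (S := sch.side k) (G := G)
  Z_pos := fun k => by
    haveI : SecondCountableTopology G := (r.continuous.isClosedEmbedding r.injective).isEmbedding.secondCountableTopology
    exact diagCyclicTraceU_side_pos r.ρ (sch.β k) ⟨sch.L k, rfl⟩ r.continuous
  w := fun k => (slicePkgAt r sch hβ k).twoShiftWeight (obsRead (sch.side k) (P.Y k) (2 * P.T k))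
  w_nonneg := fun k a b => SlicePkg.twoShiftWeight_nonneg _ _ a b
  w_summable := fun k => by
    haveI : SecondCountableTopology G := (r.continuous.isClosedEmbedding r.injective).isEmbedding.secondCountableTopology
    exact SlicePkg.summable_twoShiftWeight r.continuous (hβ k) (slicePkgAt r sch hβ k) (measurable_obsRead (P.measurable k) _)
      (abs_obsRead_le (P.bdd k) _)
  n_pos := hn0
  n_ge := hnge
  le_N := by
    filter_upwards [hreg] with k hk
    exact six_mul_add_two_mul_le_of_regime hk
  p_ge := by
    filter_upwards [hreg] with k hk
    have h1 : 6 * P.n k + 2 * (2 * P.T k + 1) ≤ sch.side k := six_mul_add_two_mul_le_of_regime hk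
    have h2 : ((sch.side k - 6 * P.n k - 2 * (2 * P.T k + 1) : ℕ) : ℝ) = (sch.side k : ℝ) - 6 * P.n k - 2 * (2 * P.T k + 1) := by
      rw [Nat.sub_sub, Nat.cast_sub (by omega)]
      push_cast
      ring
    rw [h2]
    have h3 : ((48 * P.n k + 16 * (2 * P.T k + 1) : ℕ) : ℝ) ≤ ((5 * sch.side k : ℕ) : ℝ) := by exact_mod_cast hk
    push_cast at h3
    linarith
  ident₁ := by
    filter_upwards [hreg] with k hk
    have h := hasSum_twoShift_slicePkgAt r sch hβ k (P.measurable k) (P.bdd k) (P.boxLocal k) (e := 2 * P.T k) (n := P.n k)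
      (by omega) (Nat.one_le_iff_ne_zero.2 (hn0 k)) (by omega)
    simpa only [mul_comm (swapShiftPairing r sch (P.Y k) (P.n k) k)] using h
  ident₂ := by
    filter_upwards [hreg] with k hk
    have h1 : 1 ≤ P.n k := Nat.one_le_iff_ne_zero.2 (hn0 k)
    have h := hasSum_twoShift_slicePkgAt r sch hβ k (P.measurable k) (P.bdd k) (P.boxLocal k) (e := 2 * P.T k) (n := 2 * P.n k)
      (by omega) (by omega) (by omega)
    simpa only [mul_comm (swapShiftPairing r sch (P.Y k) (2 * P.n k) k)] using h

end Summit.QuantumFields.YangMills.Cruxes.DiagonalMirrorRPR.SpectralTransfer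

end
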